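import Literature.NumberTheory.Irrationality.FischlerSprangZudilin2019.LinearForms
import HarnessLib

/-!
# Fischler–Sprang–Zudilin 2019, §4: asymptotics of the linear forms `r_{n,j}` (Lemma 3, named fact)

Topic `Literature/NumberTheory/Irrationality/FischlerSprangZudilin2019`, namespace
`Literature.NumberTheory.Irrationality.FischlerSprangZudilin2019`. Source: S. Fischler, J. Sprang, W. Zudilin,
*Many odd zeta values are irrational*, Compositio Math. **155** (2019) 938–952 = arXiv:1803.08905
[FischlerSprangZudilin2019], §4 "Asymptotic estimates of the linear forms" (held: `paper:arxiv-1803.08905`,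
arXiv text pp. 6–8, read on the page). The linear forms `r_{n,j} = ∑_{m ≥ 1} R_n(m + j/D)` are `r s D n j` of
`LinearForms.lean` (where Lemmas 1–2 of the source are PROVED).

## The source, verbatim
"The following lemma is proved along the same lines as [Sprang, Lemma 1.6] (see also [Zudilin 2018, Lemma 3]
and the second proof of [Ball–Rivoal, Lemme 3]). The difference is that here we only assume `s/(D log D)` to be
sufficiently large, whereas in [Sprang] parameter `D` is fixed and `s → ∞`.
**Lemma 3.** Assume that `s/(D log D)` is sufficiently large. (4.1) Then we have
`lim_{n→∞} r_{n,j}^{1/n} = g(x₀) < 3^{-(s+1)}` and `lim_{n→∞} r_{n,j'}/r_{n,j} = 1` for any `j, j' ∈ {1,…,D}`,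
(4.2) where `g(x) = D^{3D} (x+3)^{3D} (x+1)^{s+1}/(x+2)^{2(s+1)}` and `x₀` is the unique positive root of the
polynomial `(X+3)^D (X+1)^{s+1} - X^D (X+2)^{s+1}`."
(Proof, pp. 6–8: `c_{k,j} = R_n(n+k+j/D) > 0`, `r_{n,j} = ∑_{k ≥ 0} c_{k,j}`; the quotient `c_{k+1,j}/c_{k,j}`
tends to `f(κ)` for `k ∼ κn`, `f(x) = ((x+3)/x)^D ((x+1)/(x+2))^{s+1}`, `f'/f = (ax²+bx+c)/(x(x+1)(x+2)(x+3))`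
with `a = s+1-3D > 0`, `c = -6D < 0`, whence a unique `x₀ > 0` with `f(x₀) = 1`; Stirling at `k = ⌊x₀n⌋`
gives `c_{k,j}^{1/n} → g(x₀) f(x₀)^{x₀} = g(x₀)`; the terms with `k` near `x₀ n` dominate; and
`x₀ < 4·2^{-(s+1)/D} < ½` yields `log g(x₀) ≤ 3D log D + 3D log(7/2) + (s+1)(log(a+1) - 2 log(a+2)) < -(s+1) log 3`
once `s/(D log D)` is large.)
"**Remark 3.** For `s = 77` and `D = 4` one computes `g(x₀) < exp(-78)`." (Whence, with Lemmas 1, 2, 4: two of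
`ζ(5), …, ζ(77)` are irrational — "slightly weaker than the result of Rivoal and the third author [RZnote]",
which is the tree's `RivoalZudilin2020.theorem1`; that consequence is not restated here.)

## Rendering
* `fRatio s D x = f(x)`, `gRate s D x = g(x)`, `rootPoly s D = (X+3)^D (X+1)^{s+1} - X^D (X+2)^{s+1} ∈ ℝ[X]`.
* **Lemma 3** is the named fact `lemma3` (NOT proved here — an `L`-sized real-analysis argument): "`s/(D log D)`
  sufficiently large" is an absolute constant `C₀` with `C₀ · D log D ≤ s`, for `D ≥ 2` (for `D = 1` the
  hypothesis of the source is void of meaning; §6 uses `D` = a primorial `≥ 2`); the standing hypotheses `s` odd,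
  `s ≥ 3D` of §2 are kept; "`x₀` is the unique positive root" is part of the conclusion (existence and uniqueness,
  proved in the source's text); `r_{n,j}^{1/n}` is the real power `Real.rpow` (the `r_{n,j}` are positive, being
  sums of the positive `c_{k,j}` — `R_n(m + j/D) = 0` for `1 ≤ m < n`); limits are `Filter.Tendsto` along
  `n → ∞` through ALL `n` (the source's `n` has `Dn` even; the asymptotics do not see the parity, and in §6 `D` is
  even).
* `remark3` is the numerical claim of Remark 3, as a separate named fact.

## Not here
The proof of Lemma 3; §6 (the proof of Theorem 2 from Lemmas 1–4) is the sibling file `EliminationProof.lean`.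
Cell zeta5-irr (rung F-Z1): nothing here bears on `ζ(5)`.
-/

noncomputable section

open Filter Polynomial

namespace Literature.NumberTheory.Irrationality.FischlerSprangZudilin2019

open _root_.Topology

/-- **`f(x) = ((x+3)/x)^D ((x+1)/(x+2))^{s+1}`**, the limit of the term ratio `c_{k+1,j}/c_{k,j}` at `k ∼ xn`.
[cite: FischlerSprangZudilin2019, §4 proof of Lemma 3 (definition of f)] -/
def fRatio (s D : ℕ) (x : ℝ) : ℝ := ((x + 3) / x) ^ D * ((x + 1) / (x + 2)) ^ (s + 1)

/-- **`g(x) = D^{3D} (x+3)^{3D} (x+1)^{s+1}/(x+2)^{2(s+1)}`**. [cite: FischlerSprangZudilin2019, §4 Lemma 3 eq. (4.2)] -/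
def gRate (s D : ℕ) (x : ℝ) : ℝ :=
  (D : ℝ) ^ (3 * D) * (x + 3) ^ (3 * D) * (x + 1) ^ (s + 1) / (x + 2) ^ (2 * (s + 1))

/-- **The polynomial `(X+3)^D (X+1)^{s+1} - X^D (X+2)^{s+1}`** whose unique positive root is `x₀` (equivalently
`f(x₀) = 1`). [cite: FischlerSprangZudilin2019, §4 Lemma 3] -/
def rootPoly (s D : ℕ) : ℝ[X] := (X + C 3) ^ D * (X + C 1) ^ (s + 1) - X ^ D * (X + C 2) ^ (s + 1)

/-- `rootPoly` evaluated. [cite: FischlerSprangZudilin2019, §4 Lemma 3] -/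
theorem eval_rootPoly (s D : ℕ) (x : ℝ) :
    (rootPoly s D).eval x = (x + 3) ^ D * (x + 1) ^ (s + 1) - x ^ D * (x + 2) ^ (s + 1) := by
  simp [rootPoly]

/-- For `x > 0`: `x` is a root of `rootPoly` iff `f(x) = 1`. [cite: FischlerSprangZudilin2019, §4 proof of Lemma 3] -/
theorem eval_rootPoly_eq_zero_iff {s D : ℕ} {x : ℝ} (hx : 0 < x) :
    (rootPoly s D).eval x = 0 ↔ fRatio s D x = 1 := by
  rw [eval_rootPoly, fRatio, div_pow, div_pow, sub_eq_zero]
  have h1 : x ^ D ≠ 0 := pow_ne_zero _ hx.ne'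
  have h2 : (x + 2) ^ (s + 1) ≠ 0 := pow_ne_zero _ (by positivity)
  rw [div_mul_div_comm, div_eq_one_iff_eq (mul_ne_zero h1 h2)]

/-- **Lemma 3 of Fischler–Sprang–Zudilin 2019** (named fact, statement only; a THEOREM in print, proved there
by a de Bruijn / Stirling analysis of the dominant terms): there is an absolute constant `C₀` such that for all
odd `s ≥ 3D`, `D ≥ 2` with `s ≥ C₀ · D log D` ("`s/(D log D)` sufficiently large"): the polynomial
`(X+3)^D(X+1)^{s+1} - X^D(X+2)^{s+1}` has a unique positive root `x₀`, `g(x₀) < 3^{-(s+1)}`, and for all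
`j, j' ∈ {1, …, D}`, `lim_{n→∞} r_{n,j}^{1/n} = g(x₀)` and `lim_{n→∞} r_{n,j'}/r_{n,j} = 1`.
[cite: FischlerSprangZudilin2019, §4 Lemma 3] -/
def lemma3 : Prop :=
  ∃ C₀ : ℝ, ∀ s D : ℕ, Odd s → 3 * D ≤ s → 2 ≤ D → C₀ * ((D : ℝ) * Real.log D) ≤ s →
    ∃ x₀ : ℝ, 0 < x₀ ∧ (rootPoly s D).eval x₀ = 0 ∧
      (∀ x : ℝ, 0 < x → (rootPoly s D).eval x = 0 → x = x₀) ∧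
      gRate s D x₀ < 1 / (3 : ℝ) ^ (s + 1) ∧
      (∀ j : ℕ, 1 ≤ j → j ≤ D →
        Tendsto (fun n : ℕ => (r s D n j) ^ ((1 : ℝ) / n)) atTop (𝓝 (gRate s D x₀))) ∧
      (∀ j j' : ℕ, 1 ≤ j → j ≤ D → 1 ≤ j' → j' ≤ D →
        Tendsto (fun n : ℕ => r s D n j' / r s D n j) atTop (𝓝 1))

/-- **Remark 3** (named fact, a numerical claim of the source): for `s = 77`, `D = 4`, `g(x₀) < e^{-78}` at the
positive root `x₀`. [cite: FischlerSprangZudilin2019, §4 Remark 3] -/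
def remark3 : Prop :=
  ∀ x₀ : ℝ, 0 < x₀ → (rootPoly 77 4).eval x₀ = 0 → gRate 77 4 x₀ < Real.exp (-78)

end Literature.NumberTheory.Irrationality.FischlerSprangZudilin2019
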